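import Mathlib
import Summits.Ventures.HodgeRepro2.T5FiniteZeros
import Summits.Ventures.HodgeRepro2.T5FiniteZerosCharacters
import Summits.Ventures.HodgeRepro2.T5MuInvariantAmice
import Summits.Ventures.HodgeRepro2.T5PadicLinearTopology

/-!
# T5LambdaInvariant — the λ-invariant of a measure on `ℤ_p`, and `#{ν : ∫ν dm = 0} ≤ λ(m)`

Cell pub-hodge-repro2, Tier 5 support (seat p7; route/T5-CHECK-G-p7.md §3 S5). S5 reads
«[P3] ⇒ f_m = p^μ·P·U, P distinguished with ≤ deg P zeros in the open disc … ⇒ |Z_i| ≤ deg P_i < ∞».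
T5FiniteZerosCharacters (p400880) landed the count with `P` existential (p8's `exists_poly_of_ne_zero`).
This file names the degree: it is the λ-INVARIANT of the measure,

  `λ(m) := min {n : v_p(coeff_n f_m) = μ(m)}`

(the first coefficient of `f_m` of minimal valuation — the order of `f_m / p^μ` mod `p`), and proves
for the model `R = ℤ_p` (`m : C(ℤ_[p], ℤ_[p]) →ₗ[ℤ_[p]] ℤ_[p]` bounded, `m ≠ 0`):

* `exists_weierstrass_amice`: `f_m = p^μ · (P · U)` with `P` DISTINGUISHED of degree `λ(m)` and `U` a unit
  of `ℤ_p[[T]]` — S5's «f_m = p^μ·P·U» with `deg P = λ(m)` (Mathlib's Weierstrass preparation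
  `PowerSeries.exists_isWeierstrassFactorization` + `natDegree_eq_toNat_order_map`, on the normalised
  `g = f_m / p^μ` of T5MuInvariantAmice);
* `ncard_zeroSet_le_lambda`: `#{κ continuous : ∫κ dm = 0} ≤ λ(m)` — S5's «|Z_i| ≤ deg P_i» with the
  degree made explicit (p8's `isRoot_of_eval_eq_zero`: every killed `κ` has `κ 1 − 1` a root of `P`;
  `κ ↦ κ 1 − 1` injective);
* `map_ne_zero_of_lambda_eq_zero`: if `λ(m) = 0` — i.e. `v_p(m(1)) = μ(m)`, the constant term already
  has minimal valuation — then NO continuous character is killed: `∫κ dm ≠ 0` for every `κ`.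

Mathlib + own T5FiniteZerosCharacters (hence p8's T5FiniteZeros, T5PadicFiniteOrderCharacters,
T5AmiceTransform) + T5MuInvariantAmice (hence T5MuInvariantPadic, T5AmiceIsometry, T5AmiceInverse) +
T5PadicLinearTopology (the `IsLinearTopology ℤ_[p] ℤ_[p]` instance of the evaluation map) only.
-/

namespace Summit.Ventures.HodgeRepro2.T5LambdaInvariant

open PadicInt Filter Topology
open Summit.Ventures.HodgeRepro2
open Summit.Ventures.HodgeRepro2.T5AmiceTransform
open Summit.Ventures.HodgeRepro2.T5MuInvariantPadic
open Summit.Ventures.HodgeRepro2.T5MuInvariantAmice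

variable {p : ℕ} [hp : Fact p.Prime]
variable (m : C(ℤ_[p], ℤ_[p]) →ₗ[ℤ_[p]] ℤ_[p]) {C : ℝ}

/-- THE λ-INVARIANT of `m`: the least `n` with `v_p(coeff_n f_m) = μ(m)` (the first coefficient of
minimal valuation; `0` by convention if there is none, i.e. if `m = 0`). -/
noncomputable def lambda : ℕ :=
  sInf {n : ℕ | vp p (PowerSeries.coeff n (amice m)) = mu p m}

/-- The defining set of `λ(m)` is non-empty for `m ≠ 0`. -/
theorem nonempty_setOf_vp_coeff_eq_mu (hC : 0 ≤ C) (hb : ∀ φ, ‖m φ‖ ≤ C * ‖φ‖) (hne : m ≠ 0) :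
    {n : ℕ | vp p (PowerSeries.coeff n (amice m)) = mu p m}.Nonempty := by
  have htop : mu p m ≠ ⊤ := by
    rw [Ne, mu_eq_top_iff_eq_zero p m hC hb]
    exact hne
  obtain ⟨k, hk⟩ := ENat.ne_top_iff_exists.mp htop
  obtain ⟨n, hn⟩ := exists_vp_coeff_eq_of_mu_eq m hC hb k hk.symm
  exact ⟨n, by rw [Set.mem_setOf_eq, hn, hk]⟩

/-- `v_p(coeff_{λ(m)} f_m) = μ(m)` for `m ≠ 0`. -/
theorem vp_coeff_lambda (hC : 0 ≤ C) (hb : ∀ φ, ‖m φ‖ ≤ C * ‖φ‖) (hne : m ≠ 0) :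
    vp p (PowerSeries.coeff (lambda m) (amice m)) = mu p m :=
  Nat.sInf_mem (nonempty_setOf_vp_coeff_eq_mu m hC hb hne)

/-- `λ(m) ≤ n` for every `n` with `v_p(coeff_n f_m) = μ(m)`. -/
theorem lambda_le {n : ℕ} (h : vp p (PowerSeries.coeff n (amice m)) = mu p m) : lambda m ≤ n :=
  Nat.sInf_le h

/-- Below `λ(m)` the coefficients have valuation `> μ(m)`. -/
theorem mu_lt_vp_coeff_of_lt_lambda (hC : 0 ≤ C) (hb : ∀ φ, ‖m φ‖ ≤ C * ‖φ‖) {n : ℕ}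
    (hn : n < lambda m) : mu p m < vp p (PowerSeries.coeff n (amice m)) := by
  have hle : mu p m ≤ vp p (PowerSeries.coeff n (amice m)) := by
    rw [mu_eq_iInf_vp_coeff m hC hb]
    exact iInf_le _ n
  refine lt_of_le_of_ne hle fun h => ?_
  exact absurd (lambda_le m h.symm) (not_le.mpr hn)

/-- `λ(m) = 0 ⟺ v_p(m 1) = μ(m)` for `m ≠ 0` (the constant term `coeff_0 f_m = m(x choose 0) = m(1)`
already has the minimal valuation). -/
theorem lambda_eq_zero_iff (hC : 0 ≤ C) (hb : ∀ φ, ‖m φ‖ ≤ C * ‖φ‖) (hne : m ≠ 0) :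
    lambda m = 0 ↔ vp p (PowerSeries.coeff 0 (amice m)) = mu p m := by
  constructor
  · intro h
    have := vp_coeff_lambda m hC hb hne
    rwa [h] at this
  · intro h
    exact le_antisymm (lambda_le m h) (Nat.zero_le _)

/-- The order of the reduction mod `p` of the normalised series `g = f_m / p^μ` is `λ(m)`. -/
theorem order_map_residue_eq_lambda (hC : 0 ≤ C) (hb : ∀ φ, ‖m φ‖ ≤ C * ‖φ‖) (hne : m ≠ 0)
    (k : ℕ) (hk : mu p m = k) (g : PowerSeries ℤ_[p]) (hg : amice m = (p : ℤ_[p]) ^ k • g) :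
    (g.map (IsLocalRing.residue ℤ_[p])).order = lambda m := by
  have hcoeff : ∀ n, vp p (PowerSeries.coeff n (amice m)) = k + vp p (PowerSeries.coeff n g) := by
    intro n
    rw [hg, PowerSeries.coeff_smul, smul_eq_mul, vp_pow_mul]
  have hunit : ∀ n, IsUnit (PowerSeries.coeff n g) ↔ vp p (PowerSeries.coeff n (amice m)) = mu p m := by
    intro n
    rw [← vp_eq_zero_iff_isUnit, hcoeff n, hk]
    constructor
    · intro h
      rw [h, add_zero]
    · intro h
      have h' : (k : ℕ∞) + vp p (PowerSeries.coeff n g) = (k : ℕ∞) + 0 := by rw [h, add_zero]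
      exact WithTop.add_left_cancel (WithTop.natCast_ne_top k) h'
  have hres : ∀ n, PowerSeries.coeff n (g.map (IsLocalRing.residue ℤ_[p])) ≠ 0 ↔
      IsUnit (PowerSeries.coeff n g) := by
    intro n
    rw [PowerSeries.coeff_map, Ne, IsLocalRing.residue_eq_zero_iff, IsLocalRing.notMem_maximalIdeal]
  rw [PowerSeries.order_eq_nat]
  refine ⟨?_, fun i hi => ?_⟩
  · rw [hres, hunit]
    exact vp_coeff_lambda m hC hb hne
  · by_contra h
    change PowerSeries.coeff i (g.map (IsLocalRing.residue ℤ_[p])) ≠ 0 at h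
    rw [hres, hunit] at h
    exact absurd (lambda_le m h) (not_le.mpr hi)

/-- WEIERSTRASS PREPARATION for `f_m` with the degree named: for `m ≠ 0` with `μ(m) = k`,
`f_m = p^k · (P · U)` with `P ∈ ℤ_p[T]` distinguished of degree `λ(m)` and `U ∈ ℤ_p[[T]]` a unit —
S5's «f_m = p^μ·P·U», `deg P = λ(m)`. -/
theorem exists_weierstrass_amice (hC : 0 ≤ C) (hb : ∀ φ, ‖m φ‖ ≤ C * ‖φ‖) (hne : m ≠ 0)
    (k : ℕ) (hk : mu p m = k) :
    ∃ (P : Polynomial ℤ_[p]) (U : PowerSeries ℤ_[p]),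
      P.IsDistinguishedAt (IsLocalRing.maximalIdeal ℤ_[p]) ∧ IsUnit U ∧ P.natDegree = lambda m ∧
      amice m = PowerSeries.C ((p : ℤ_[p]) ^ k) * (↑P * U) := by
  obtain ⟨g, hg, -, n₀, hn₀⟩ := exists_amice_eq_pow_smul m hC hb k hk
  have hgmap : g.map (IsLocalRing.residue ℤ_[p]) ≠ 0 :=
    T5FiniteZeros.map_residue_ne_zero_of_isUnit_coeff hn₀
  obtain ⟨P, U, H⟩ := PowerSeries.exists_isWeierstrassFactorization hgmap
  refine ⟨P, U, H.isDistinguishedAt, H.isUnit, ?_, ?_⟩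
  · rw [H.natDegree_eq_toNat_order_map, order_map_residue_eq_lambda m hC hb hne k hk g hg]
    rfl
  · rw [hg, PowerSeries.smul_eq_C_mul, H.eq_mul]

/-- S5's COUNT with the degree named: `#{κ continuous : ∫κ dm = 0} ≤ λ(m)` for `m ≠ 0`. -/
theorem ncard_zeroSet_le_lambda (hC : 0 ≤ C) (hb : ∀ φ, ‖m φ‖ ≤ C * ‖φ‖) (hne : m ≠ 0) :
    {κ : {κ : AddChar ℤ_[p] ℤ_[p] // Continuous κ} | m ⟨κ.1, κ.2⟩ = 0}.ncard ≤ lambda m := by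
  have hm : Continuous m := continuous_of_bound m C hb
  have htop : mu p m ≠ ⊤ := by
    rw [Ne, mu_eq_top_iff_eq_zero p m hC hb]
    exact hne
  obtain ⟨k, hk⟩ := ENat.ne_top_iff_exists.mp htop
  obtain ⟨P, U, hP, hU, hdeg, hfact⟩ := exists_weierstrass_amice m hC hb hne k hk.symm
  have hP0 : P ≠ 0 := hP.monic.ne_zero
  have hc : (p : ℤ_[p]) ^ k ≠ 0 := pow_ne_zero _ (Nat.cast_ne_zero.mpr hp.out.ne_zero)
  classical
  have hsub : ∀ κ ∈ {κ : {κ : AddChar ℤ_[p] ℤ_[p] // Continuous κ} | m ⟨κ.1, κ.2⟩ = 0},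
      κ.1 1 - 1 ∈ (↑P.roots.toFinset : Set ℤ_[p]) := by
    intro κ hκ
    simp only [Set.mem_setOf_eq] at hκ
    rw [Finset.mem_coe, Multiset.mem_toFinset, Polynomial.mem_roots hP0]
    have h := T5FiniteZeros.isRoot_of_eval_eq_zero hc hU hfact
      (PowerSeries.aeval (hasEval_eval_one_sub_one κ.1 κ.2))
      (by rw [aeval_amice_eq_map m hm κ.1 κ.2]; exact hκ)
    rwa [T5FiniteZerosCharacters.aeval_X_eq] at h
  calc {κ : {κ : AddChar ℤ_[p] ℤ_[p] // Continuous κ} | m ⟨κ.1, κ.2⟩ = 0}.ncard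
      ≤ (↑P.roots.toFinset : Set ℤ_[p]).ncard :=
        Set.ncard_le_ncard_of_injOn _ hsub
          (T5PadicFiniteOrderCharacters.eval_one_sub_one_injective.injOn) (Finset.finite_toSet _)
    _ = P.roots.toFinset.card := Set.ncard_coe_finset _
    _ ≤ P.roots.card := Multiset.toFinset_card_le _
    _ ≤ P.natDegree := Polynomial.card_roots' P
    _ = lambda m := hdeg

/-- `λ(m) = 0` (the constant term `m(1)` has minimal valuation) ⇒ NO continuous character is killed
by `m`: `∫κ dm ≠ 0` for every `κ`. -/
theorem map_ne_zero_of_lambda_eq_zero (hC : 0 ≤ C) (hb : ∀ φ, ‖m φ‖ ≤ C * ‖φ‖) (hne : m ≠ 0)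
    (hl : lambda m = 0) (κ : AddChar ℤ_[p] ℤ_[p]) (hκ : Continuous κ) : m ⟨κ, hκ⟩ ≠ 0 := by
  intro h0
  have hfin : {κ : {κ : AddChar ℤ_[p] ℤ_[p] // Continuous κ} | m ⟨κ.1, κ.2⟩ = 0}.Finite :=
    T5FiniteZerosCharacters.finite_zeroSet_addChar m (continuous_of_bound m C hb) hne
  have hmem : (⟨κ, hκ⟩ : {κ : AddChar ℤ_[p] ℤ_[p] // Continuous κ}) ∈
      {κ : {κ : AddChar ℤ_[p] ℤ_[p] // Continuous κ} | m ⟨κ.1, κ.2⟩ = 0} := h0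
  have hpos : 0 < {κ : {κ : AddChar ℤ_[p] ℤ_[p] // Continuous κ} | m ⟨κ.1, κ.2⟩ = 0}.ncard :=
    Set.ncard_pos hfin |>.mpr ⟨_, hmem⟩
  have := ncard_zeroSet_le_lambda m hC hb hne
  rw [hl] at this
  exact absurd this (not_le.mpr hpos)

/-- The finite-order form: `#{ν ∈ Ξ_𝔭 : ∫ν dm = 0} ≤ λ(m)` — S5's «|Z_i| ≤ deg P_i» on `Ξ_𝔭`. -/
theorem ncard_zeroSet_finiteOrder_le_lambda (hC : 0 ≤ C) (hb : ∀ φ, ‖m φ‖ ≤ C * ‖φ‖) (hne : m ≠ 0) :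
    {κ : {κ : AddChar ℤ_[p] ℤ_[p] // Continuous κ} |
      (∃ k : ℕ, ∀ x : ℤ_[p], κ.1 x ^ (p ^ k) = 1) ∧ m ⟨κ.1, κ.2⟩ = 0}.ncard ≤ lambda m :=
  (Set.ncard_le_ncard (fun _ h => h.2)
    (T5FiniteZerosCharacters.finite_zeroSet_addChar m (continuous_of_bound m C hb) hne)).trans
    (ncard_zeroSet_le_lambda m hC hb hne)

end Summit.Ventures.HodgeRepro2.T5LambdaInvariant
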